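import Summits.ResolutionOfSingularities.ResolutionOfSingularities.Theorems.HilbertSamuelEliminationSigmaMaxModificationsCorridor3WLadderIsoRestartDefs
import Summits.ResolutionOfSingularities.ResolutionOfSingularities.Theorems.HilbertSamuelEliminationSigmaMaxModificationsCorridor3WLadderIsoRestartLabels
import Summits.ResolutionOfSingularities.ResolutionOfSingularities.Theorems.HilbertSamuelEliminationSigmaMaxModificationsCorridor3WLadderIsoRestartBlowup
import Summits.ResolutionOfSingularities.ResolutionOfSingularities.Theorems.HilbertSamuelEliminationSigmaMaxModificationsCorridor3WLadderIsoRestartPrune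
import Summits.ResolutionOfSingularities.ResolutionOfSingularities.Theorems.HilbertSamuelEliminationSigmaMaxModificationsCorridor3WLadderStrataScope
import Literature.AlgebraicGeometry.Resolution.Blowups
import HarnessLib

/-!
# [OURS · L1 W4.2] D8-S1 file 5: the SIMULATION RELATION of the run-level Zariski localisation — the pending-cycle relation
# `PendRel`, the simulation relation `SimRel`, Cartier-trivial schemes and the history relation `HistRel` of a pending cycle
# (crux chain w42, v7/v8.1 stub `stub_isoOpenRestartLocal` ⟸ `LocalRunSimulationM p`; hand res-D-pv-060)

OURS bookkeeping (cell `res-hironaka`, slot W4.2, crux `stmt-ResolutionOfSingularities-18506` / conjunct `-19249`; `--supports … --as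
helper`, counted 0); NOT statements of the manuscript under review [claim: Hironaka2017, status: under-review] nor of [CossartJannsenSaito2020]
(cited as a POINTER: Thm. 1.2's compatibility with Zariski localisation, Rem. 6.29 (1)'s labelled machine). AI bookkeeping, weaker than expert review.

The proof of `LocalRunSimulationM p` (`…IsoRestartDefs`, p513760) runs the labelled canonical-step machine of the pointed open `U` ALONGSIDE the
global chain, one simulation state per global stage (D8-S1 DESIGN §5–§6). A state over the global stage `s` is a marked stage `u` of the
open's run with an open immersion `ι : u.W ⟶ s.W` such that (`SimRel`): `ι u.pt = s.pt`, the open side satisfies the cycle invariant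
(`CycleInv`, stub-4's `…StrataScope`), the label ORDERS agree on the components of the stratum meeting the open (`LabelRel`, file 2), and the
cycle states are related (`PendRel`): (a) both between cycles; (b) the global cycle's replayed subscheme misses the open; (c) the global cycle
is relevant but not yet started on the open — the reduced structure on the open's least non-empty label part embeds openly and cartesianly
into the replayed subscheme and the oracle names on it the pruned pull-back of the remaining centres; (d) both inside the cycle, the open's
replayed subscheme being the cartesian restriction of the global one with the pruned pulled-back remaining centres. The stage `c 0` of
`LocalRunSimulationM` is only REACHED, so it may be met mid-cycle: the oracle's answer needed by (c) at `m = 0` comes from the HISTORY of the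
pending cycle (`HistRel`: the replayed subscheme is reduced and its remaining centres are, on every CARTIER-TRIVIAL open piece, the pruned
pull-back of a sequence the oracle names — Cartier-trivial pieces miss every exceptional divisor). This file: the definitions, their
unfolding lemmas, and small geometric helpers (push-forward supports, blow-up uniqueness off the centre, the pruned tail). [folklore]
-/

noncomputable section

set_option linter.dupNamespace false -- mandated namespace of this single-conjunct summit

open CategoryTheory CategoryTheory.Limits AlgebraicGeometry TopologicalSpace
open Summit.ResolutionOfSingularities.ResolutionOfSingularities.Theorems.CampaignW42
open Literature.AlgebraicGeometry.Resolution Literature.RingTheory.HilbertSamuel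
open Literature.AlgebraicGeometry.CossartJannsenSaito2020
open Summit.ResolutionOfSingularities.ResolutionOfSingularities.Theorems.SigmaMaxModificationsCorridor3
open Summit.ResolutionOfSingularities.ResolutionOfSingularities.Theorems.SigmaMaxModificationsCorridor3.Moving
open Summit.ResolutionOfSingularities.ResolutionOfSingularities.Theorems.SigmaMaxModificationsCorridor3.Helpers (QPointed)

universe u

namespace Summit.ResolutionOfSingularities.ResolutionOfSingularities.Cruxes.SigmaMaxModifications.IdeasL1Idea2R4

/-! ## §0. Definitions: the pending-cycle relation and the simulation relation -/

/-- [OURS · D8-S1] **THE PENDING-CYCLE RELATION** between the cycle state of a stage `W` (global run) and the cycle state of its open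
`V` (run of the pointed open; `ι : V ⟶ W` the open immersion, `LV` the bookkeeping on `V`):
* (a) `none / none` — both runs are between cycles;
* (b) `some P / none`, the global cycle is IRRELEVANT for the open: its replayed subscheme misses the range of `ι`;
* (c) `some P / none`, the global cycle is relevant but NOT YET STARTED on the open: the least non-empty label part `T` of the open (closed)
  carries an open immersion `jP : V(𝓘_T) ⟶ P.src` of its reduced structure into the replayed subscheme, cartesian over `ι`, and the
  oracle names on `V(𝓘_T)` the pruned pull-back `(P.rest|_{jP}).prune` of the centres still to be replayed;
* (d) `some P / some Q` — both inside the cycle: an open immersion `jP : Q.src ⟶ P.src`, cartesian over `ι` (`Q.hom` is the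
  restriction of `P.hom`), with `Q.rest = (P.rest|_{jP}).prune`;
* `none / some _` never happens.
OURS bookkeeping; NOT a statement of the manuscript. [folklore] -/
def PendRel (R : ∀ S : Scheme.{u}, CentreSeq S → Prop) (N : ℕ) (ν : ℕ → ℕ) {V W : Scheme.{u}} (ι : V ⟶ W)
    (LV : Labelling V) : Option (Pending W) → Option (Pending V) → Prop
  | none, none => True
  | none, some _ => False
  | some P, none =>
      Disjoint (Set.range P.hom.base) (Set.range ι.base) ∨
        ∃ (j : ℕ) (hcl : IsClosed (LV.part (Scheme.hsStratum V N ν) j))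
          (jP : (Scheme.IdealSheafData.vanishingIdeal ⟨LV.part (Scheme.hsStratum V N ν) j, hcl⟩).subscheme ⟶ P.src),
          IsLeast {i | (LV.part (Scheme.hsStratum V N ν) i).Nonempty} j ∧ IsOpenImmersion jP ∧
            IsPullback jP (Scheme.IdealSheafData.vanishingIdeal ⟨LV.part (Scheme.hsStratum V N ν) j, hcl⟩).subschemeι
              P.hom ι ∧
            R _ (P.rest.comap jP).prune
  | some P, some Q =>
      ∃ jP : Q.src ⟶ P.src, IsOpenImmersion jP ∧ IsPullback jP Q.hom P.hom ι ∧ Q.rest = (P.rest.comap jP).prune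

/-- [OURS · D8-S1] **THE SIMULATION RELATION** between a global stage `s` and a stage `u` of the run of the pointed open, along
`ι : u.W ⟶ s.W`: `ι` is an open immersion carrying marked point to marked point, `u` satisfies the cycle invariant (over the field
`k`), the label orders agree on the components meeting the open (`LabelRel`), and the cycle states are related (`PendRel`).
OURS bookkeeping; NOT a statement of the manuscript. [folklore] -/
structure SimRel (k : Type u) [Field k] (R : ∀ S : Scheme.{u}, CentreSeq S → Prop) (N : ℕ) (ν : ℕ → ℕ)
    (s u : MarkedStage.{u}) (ι : u.W ⟶ s.W) : Prop where
  /-- `ι` is an open immersion -/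
  isOpenImmersion : IsOpenImmersion ι
  /-- marked point to marked point -/
  base_pt : ι.base u.pt = s.pt
  /-- the cycle invariant on the open side -/
  cycleInv : CycleInv k R N ν u
  /-- label orders agree on the components meeting the open -/
  labelRel : LabelRel ι (Scheme.hsStratum s.W N ν) s.L u.L
  /-- the cycle states are related -/
  pendRel : PendRel R N ν ι u.L s.P u.P

variable {R : ∀ S : Scheme.{u}, CentreSeq S → Prop} {N : ℕ} {ν : ℕ → ℕ}

/-- Unfolding, case (b)/(c). [folklore] -/
theorem pendRel_some_none_iff {V W : Scheme.{u}} (ι : V ⟶ W) (LV : Labelling V) (P : Pending W) :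
    PendRel R N ν ι LV (some P) none ↔
      Disjoint (Set.range P.hom.base) (Set.range ι.base) ∨
        ∃ (j : ℕ) (hcl : IsClosed (LV.part (Scheme.hsStratum V N ν) j))
          (jP : (Scheme.IdealSheafData.vanishingIdeal ⟨LV.part (Scheme.hsStratum V N ν) j, hcl⟩).subscheme ⟶ P.src),
          IsLeast {i | (LV.part (Scheme.hsStratum V N ν) i).Nonempty} j ∧ IsOpenImmersion jP ∧
            IsPullback jP (Scheme.IdealSheafData.vanishingIdeal ⟨LV.part (Scheme.hsStratum V N ν) j, hcl⟩).subschemeι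
              P.hom ι ∧
            R _ (P.rest.comap jP).prune := Iff.rfl

/-- Unfolding, case (d). [folklore] -/
theorem pendRel_some_some_iff {V W : Scheme.{u}} (ι : V ⟶ W) (LV : Labelling V) (P : Pending W) (Q : Pending V) :
    PendRel R N ν ι LV (some P) (some Q) ↔
      ∃ jP : Q.src ⟶ P.src, IsOpenImmersion jP ∧ IsPullback jP Q.hom P.hom ι ∧ Q.rest = (P.rest.comap jP).prune :=
  Iff.rfl

/-- Unfolding: `none / some` is impossible. [folklore] -/
theorem not_pendRel_none_some {V W : Scheme.{u}} (ι : V ⟶ W) (LV : Labelling V) (Q : Pending V) :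
    ¬ PendRel R N ν ι LV none (some Q) := fun h => h

/-- Unfolding, case (a). [folklore] -/
theorem pendRel_none_none {V W : Scheme.{u}} (ι : V ⟶ W) (LV : Labelling V) : PendRel R N ν ι LV none none := trivial


/-! ## §4. The history of the replayed subscheme: where the oracle's answers on the open pieces come from -/

/-- [OURS · D8-S1] **CARTIER-TRIVIAL schemes**: every effective Cartier divisor is the empty one (e.g. a reduced scheme with at most one
point). An open immersion from such a scheme into a blow-up misses the exceptional divisor. OURS bookkeeping. [folklore] -/
def CartierTrivial (V : Scheme.{u}) : Prop :=
  ∀ I : V.IdealSheafData, IsEffectiveCartier I → I = ⊤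

/-- [OURS · D8-S1] **THE HISTORY RELATION of a pending cycle** `Q` (for the oracle `R`): the replayed subscheme `Q.src` is reduced, and
there are a scheme `S₀` with a sequence `t₀` NAMED by `R` and a morphism `f : Q.src ⟶ S₀` (the composite blow-down to the cycle's
original part) such that every open immersion `g : V ⟶ Q.src` from a Cartier-trivial `V` composes with `f` to an OPEN IMMERSION along
which `t₀` pulls back, after pruning, to the pruned pull-back of the remaining centres `Q.rest` along `g`. With a LOCAL oracle this is
what makes `R` answer on the reduced point pieces of `Q.src` (D8-S1 DESIGN §6: the stage `c 0` may be met mid-cycle). OURS bookkeeping;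
NOT a statement of the manuscript. [folklore] -/
structure HistRel (R : ∀ S : Scheme.{u}, CentreSeq S → Prop) {W : Scheme.{u}} (Q : Pending W) : Prop where
  /-- the replayed subscheme is reduced -/
  isReduced : IsReduced Q.src
  /-- the remaining centres are the pull-back of a named sequence, on Cartier-trivial open pieces -/
  named : ∃ (S₀ : Scheme.{u}) (t₀ : CentreSeq S₀) (f : Q.src ⟶ S₀), R S₀ t₀ ∧
    ∀ (V : Scheme.{u}) (g : V ⟶ Q.src), IsOpenImmersion g → CartierTrivial V →
      IsOpenImmersion (g ≫ f) ∧ (t₀.comap (g ≫ f)).prune = (Q.rest.comap g).prune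


/-! ## §1. Small geometric helpers -/

/-- The push-forward of a centre along a closed immersion is supported inside its range. [folklore] -/
theorem support_map_subset_range {S W : Scheme.{u}} (φ : S ⟶ W) [IsClosedImmersion φ] (D : S.IdealSheafData) :
    ((D.map φ).support : Set W) ⊆ Set.range φ.base := by
  have h1 : (D.map φ).support ≤ φ.ker.support := Scheme.IdealSheafData.support_antitone (ker_le_map D φ)
  refine (show ((D.map φ).support : Set W) ⊆ (φ.ker.support : Set W) from h1).trans ?_
  rw [Scheme.Hom.support_ker, φ.isClosedEmbedding.isClosed_range.closure_eq]

/-- The range of the next replayed closed immersion lies over the range of the current one. [folklore] -/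
theorem range_subset_preimage_of_comp_eq {S S' W W' : Scheme.{u}} {φ : S ⟶ W} {φ' : S' ⟶ W'} {πS : S' ⟶ S} {πW : W' ⟶ W}
    (h : φ' ≫ πW = πS ≫ φ) : Set.range φ'.base ⊆ πW.base ⁻¹' Set.range φ.base := by
  rintro _ ⟨y, rfl⟩
  refine ⟨πS.base y, ?_⟩
  rw [← Scheme.Hom.comp_apply, ← h, Scheme.Hom.comp_apply]

/-- Disjointness from the open is inherited one blow-up up. [folklore] -/
theorem disjoint_of_subset_preimage {W W' : Scheme.{u}} {πW : W' ⟶ W} {A B : Set W} {A' B' : Set W'}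
    (hA : A' ⊆ πW.base ⁻¹' A) (hB : B' = πW.base ⁻¹' B) (h : Disjoint A B) : Disjoint A' B' := by
  rw [hB]
  exact (h.preimage πW.base).mono hA le_rfl

/-- In a cartesian square over the open immersion `ι` the restricted closed immersion has range `ι⁻¹(range φ)`. [folklore] -/
theorem range_snd_eq_preimage_range_of_isPullback {S S' V W : Scheme.{u}} {φ : S ⟶ W} {ι : V ⟶ W} {jP : S' ⟶ S} {φ' : S' ⟶ V}
    (H : IsPullback jP φ' φ ι) : Set.range φ'.base = ι.base ⁻¹' Set.range φ.base :=
  range_eq_preimage_range_of_isPullback H.flip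

/-- **Blow-up uniqueness off the centre**: a morphism `g : S' ⟶ Bl_D(S)` over `jP : S' ⟶ S` with `jP^* D = ⊤` IS the canonical lift
`π_{jP^*D}⁻¹ ≫ Bl(jP)`. [cite: GortzWedhorn2020, Prop. 13.91 (1)] -/
theorem eq_inv_comp_comapMap_of_comp_π_eq {S S' : Scheme.{u}} {D : S.IdealSheafData} {jP : S' ⟶ S} (hD : D.comap jP = ⊤)
    {g : S' ⟶ blowup D} (hg : g ≫ blowup.π D = jP) :
    haveI := CentreSeq.isIso_blowup_π_of_eq_top hD
    g = inv (blowup.π (D.comap jP)) ≫ blowup.comapMap D jP := by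
  haveI := CentreSeq.isIso_blowup_π_of_eq_top hD
  refine (blowup.isBlowup D).hom_ext ?_ ?_
  · rw [hg, hD]
    exact isEffectiveCartier_top
  · rw [hg, Category.assoc, blowup.comapMap_π, IsIso.inv_hom_id_assoc]

/-- The pruned pull-back of `cons D t₁` along `jP` with `jP^* D = ⊤` is the pruned pull-back of the tail along ANY lift of `jP` into
`Bl_D`. [cite: Kollar2007, 3.34.1 (p. 131)] -/
theorem prune_comap_cons_eq_of_lift {S S' : Scheme.{u}} (D : S.IdealSheafData) (t₁ : CentreSeq (blowup D)) {jP : S' ⟶ S}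
    (hD : D.comap jP = ⊤) {g : S' ⟶ blowup D} (hg : g ≫ blowup.π D = jP) :
    ((CentreSeq.cons D t₁).comap jP).prune = (t₁.comap g).prune := by
  rw [prune_comap_cons_of_eq_top D t₁ jP hD, ← eq_inv_comp_comapMap_of_comp_π_eq hD hg]



end Summit.ResolutionOfSingularities.ResolutionOfSingularities.Cruxes.SigmaMaxModifications.IdeasL1Idea2R4

end
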